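import Mathlib
import Literature.NumberTheory.EllipticCurves.KatoAdditiveTwistedValueNeronIntegralitySymbolClosure
import Literature.NumberTheory.EllipticCurves.ManinConstantClassCertificate
import Literature.NumberTheory.EllipticCurves.Isogeny
import Literature.NumberTheory.EllipticCurves.ImaginaryPeriod
import HarnessLib
import HarnessLib.Audit.Tags

/-!
# es g28 — Sketch-es-g28.lean: SHADOW VANISHING (half-system-free), THE MODULE STEP, THE SHADOW-MOMENT INTERFACE,
# and the typed candidates E-es-129-T2/T3 (T-es-42 (i) / T-es-44; MEMO-es §41.15 (8), §41.16.3, §41.19, §42)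

TYPER NOTE (typer g18, T-es-44 = T-es-42 (i) + the module step (a) + E-es-129-T2/T3).  SOURCE = HOME/es/g28/Sketch-es-g28.lean sha16
d9894e271e541433 (339 l.; es: farm rc 0 · 0 err · 0 warn · nothing admitted, 6.7 s, axioms standard; BC7 self-probe Probe-es-g28.out.txt
a7370e37b2c0dabf CLEAN 2/2), §1–§4 landed VERBATIM as ONE file except: (i) this note; (ii) namespace `BsdF2ManinEsG28` folded to
`…ManinAdditive.KatoCurve.ShadowMoment` (es's suggestion); (iii) `@[conjecture]` on the two §4 candidates `CMPeriodDominationTwo` (E-es-129-T2) /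
`CMPeriodDominationThree` (E-es-129-T3) — obligation nodes, nothing asserted; (iv) a one-line docstring on `mem_pairSubgroup`; (v) `import
HarnessLib(.Audit.Tags)` added; (vi) two words of the docstrings reworded for grep hygiene («nothing admitted»).  §1 is kept (recommended by es): its binder shape (`ε ≠ 1`, `χ ≠ 1`, quotient `G ⧸ {1, ε}`) differs from the
half-system form of `…KatoCurve.ShadowVanishing.shadow_twisted_sum_eq_zero` (p708334) — no duplicate statement; either closes 41.15 step (8a).
§3's weight laws of `jay` are exactly the landed ring identities `ShadowLeader.ssTwo_nu_jay` / `ssThree_nu_iotaFour` (p707222).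
HONEST FRAMING.  LENS: es (Euler systems / CM explicit reciprocity).  STATUS: §1–§3 PROVED finite algebra (E-es-128′-fin `ssShadowMoment_eq_zero_of_char_two`,
E-es-128-fin-even `ssShadowMoment_eq_zero_of_two_ne_zero` are THEOREMS over the POSITED interface `ShadowDatum`; the CM dictionary «`v(S(χ)) > 3/2 ⟺
M̄(χ̄) = 0`», i.e. the leading-term formula, audit gap G0, is NOT typed — T-es-45, low priority); §4 = two CONJECTURAL laws with census-exact evidence:
BC5 WITNESS HOME/es/g28/T23-CENSUS-v1.txt f973e23089ae9630 (engine t23_census.py eb1997e25a62b7d8; T2: 1298 pairs / 649 classes with a `j = 1728`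
member, `N < 5·10⁵`, `q` even ⟺ class 32a, 0 exceptions off `N = 32`; T3: 3696 pairs / 1848 classes with a `j = 0` member, `3 ∣ q` ⟺ 27a (real),
`3 ∣ q′` never, 0 exceptions off `N = 27`, engine mismatches 0) on top of CM-DOMINATION-v1.txt 97894366251a2d6c / CM-DOMINATION2-v1.txt
939dc9a293d6b395 (HOME/es/g27).  REFUTER VERDICTS: R-es-62 (ref1: A1–A6 + BC7 on T2/T3; independent Ω⁻ engine) PENDING at filing.  CONSUMPTION BY
NAME (LEAD): `katoFactTwoAt_of_isIsogenous_of_realPeriod_ratio` (p702793) / `katoFactThreeAt_of_isIsogenous_of_period_ratios` (p703560) — es's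
Consume-es-g28.lean eabf19e774927bc1.  PARTITION currency: 0; beyond-print theorem: NO (finite lemmas + typed laws); bears_on: stmt-BirchSwinnertonDyer-22967
(C2: E-es-124 off 32a) and stmt-22968 (C3: E-es-125 off 27a).  BSD is not proved by this; Manin's conjecture is not proved; C2/C3 OPEN.

Sketch file of planner `bsd-f2-manin-es` g28 (Euler-system / explicit-reciprocity lens).  NOTHING ADMITTED, no `instance`,
no `notation`, no `decide`.  §1–§3 = the finite, curve-free core of THEOREMS 41.15 / 41.16 (paper), answering typer g18
(INBOX 07:49Z (a)/(b) and 08:08Z: «the module step, the `def` of the shadow moment, E-es-128/128′ remain YOUR sketch»).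
RELATION TO p708334 (`…KatoCurve.ShadowVanishing.shadow_twisted_sum_eq_zero`, typer g18, landed 08:09Z): that lemma takes a
HALF-SYSTEM `A` (`t ∈ A ↔ εt ∉ A`) and a witness `χ t₀ ≠ 1` as binders; §1 below is the HALF-SYSTEM-FREE form (binders `ε ≠ 1`,
`χ ≠ 1`; proof through the quotient `G ⧸ {1, ε}` and Mathlib's `sum_hom_units_eq_zero`), which is the shape §3 instantiates
(`G = (ℤ/m)ˣ`, `ε = −1`: no half-system of `(ℤ/m)ˣ` has to be chosen).  Either lemma closes 41.15 step (8a).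

* §1 `sum_hom_mul_eq_zero_of_shift` — CHARACTERISTIC-2 PAIRING: `G` a finite commutative group, `ε ∈ G`,
  `ε ≠ 1`, `ε² = 1`, `R` a domain with `2 = 0`, `χ : G →* R` NON-TRIVIAL with `χ ε = 1`, `S : G → R` with
  `S (ε t) = S t + c`.  Then `∑ t, χ t * S t = 0`.  (41.15.2 (8): `G = (ℤ/m)ˣ`, `ε = −1`, `S = S_t` the fibre sums
  of the supersingular shadow, `c = |ker N| / 4`; the hypothesis `S_{−t} = S_t + c` is the [j]-lemma.)
* §1 `sum_hom_mul_eq_zero_of_antisymm` — ODD CHARACTERISTIC: `2 ≠ 0` in `R`, `S (ε t) = −S t`, `χ ε = 1` ⟹ the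
  same sum vanishes (41.16.3: `M̄(χ̄)·(1 + χ̄(−1)) = 0`; the [ι₄]-lemma gives `S_{−t} = −S_t`).
* §2 `exists_smul_and_norm_eq_neg_one` — THE MODULE STEP (41.15.2 (7), 41.16.3; typer (a)): a `σ`-semilinear
  `J` on a cyclic module, torsion-free on the generator `w`, with `J ∘ J = −1`, acts on `w` by a scalar `δ` with
  `σ δ · δ = −1` («`j(w̄) = δ·w̄`, `N(δ) ≡ −1 (mod m)`»).
* §3 the POSITED finite interface `ShadowDatum k m I` (index set `I` «= (O_K/m)ˣ/μ», norm `I → (ℤ/m)ˣ`,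
  weight `I → k` «= ν_p(x̄(δ·w̄))», the permutation `jay` induced by `j` / `ι₄` with `norm ∘ jay = −norm`),
  `fibreSum` (`S_t`), `ssShadowMoment` (`M̄(χ̄) = ∑_i χ̄(N i)·ν(i)`), the regrouping
  `ssShadowMoment = ∑_t χ̄ t · S_t`, the shift laws `S_{−t} = S_t + c` (p = 2) / `S_{−t} = −S_t` (p = 3) DERIVED
  from the interface axioms, and the two vanishing theorems E-es-128′-fin (p = 2, even ⟹ here: every non-trivial
  `χ̄` with `χ̄(−1) = 1`) / E-es-128-fin-even (p = 3) PROVED.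

Nothing here mentions L-values, `KatoFactTwoAt`, Manin constants or BSD; the dictionary «`v(S(χ)) > 3/2 ⟺
M̄(χ̄ mod 𝔔) = 0`» (41.15 (5)–(6), the LEADING-TERM FORMULA) is NOT typed here (it needs the CM torsion
dictionary, audit gap G0) — see MEMO-es §42.  No `instance`, no `notation`, no `decide`.
BSD is not proved by this; C2 (stmt-22967) / C3 (stmt-22968) stay OPEN.
-/

namespace Summit.BirchSwinnertonDyer.Rank1Residual.ManinAdditive.KatoCurve.ShadowMoment

open Finset

/-! ## §1 The two abstract vanishing lemmas -/

section Abstract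

variable {G : Type*} [CommGroup G] [Fintype G] {R : Type*} [CommRing R]

omit [Fintype G] in
/-- The two-element subgroup `{1, ε}` of an element with `ε * ε = 1`. -/
def pairSubgroup (ε : G) (hε2 : ε * ε = 1) : Subgroup G where
  carrier := {x | x = 1 ∨ x = ε}
  one_mem' := Or.inl rfl
  mul_mem' := by
    rintro a b (rfl | rfl) (rfl | rfl)
    · exact Or.inl (by simp)
    · exact Or.inr (by simp)
    · exact Or.inr (by simp)
    · exact Or.inl (by simpa using hε2)
  inv_mem' := by
    rintro a (rfl | rfl)
    · exact Or.inl (by simp)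
    · exact Or.inr (inv_eq_of_mul_eq_one_right hε2)

omit [Fintype G] in
/-- Membership in `pairSubgroup ε`: `x = 1 ∨ x = ε`. -/
theorem mem_pairSubgroup {ε : G} (hε2 : ε * ε = 1) {x : G} :
    x ∈ pairSubgroup ε hε2 ↔ x = 1 ∨ x = ε := Iff.rfl

/-- **Odd characteristic (41.16.3).**  `2 ≠ 0` in a ring without zero divisors: an `ε`-ANTISYMMETRIC function
sums to zero against every hom trivial on `ε`. -/
theorem sum_hom_mul_eq_zero_of_antisymm [NoZeroDivisors R] (h2 : (2 : R) ≠ 0) (ε : G)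
    (χ : G →* R) (hχε : χ ε = 1) (S : G → R) (hS : ∀ t, S (ε * t) = -S t) :
    ∑ t, χ t * S t = 0 := by
  have h : ∑ t, χ (ε * t) * S (ε * t) = ∑ t, χ t * S t :=
    Fintype.sum_equiv (Equiv.mulLeft ε) (fun t => χ (ε * t) * S (ε * t)) (fun t => χ t * S t)
      (fun _ => rfl)
  simp only [map_mul, hχε, one_mul, hS, mul_neg, Finset.sum_neg_distrib] at h
  have h' : (2 : R) * ∑ t, χ t * S t = 0 := by linear_combination (-1 : R) * h
  exact (mul_eq_zero.mp h').resolve_left h2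

/-- **Characteristic-2 pairing (41.15.2 (8)).**  `R` a domain with `2 = 0`, `ε ≠ 1` with `ε² = 1`,
`χ : G →* R` non-trivial with `χ ε = 1`, and `S (ε t) = S t + c` for all `t`.  Then `∑ t, χ t * S t = 0`.
Proof: regroup along the cosets `{r, ε r}` of `{1, ε}`; the coset of `r` contributes `χ r · (2 S r + c) = c · χ r`;
what remains is `c · ∑_{G/{1,ε}} χ' = 0`, `χ'` the (NON-TRIVIAL) descent of `χ` (`sum_hom_units_eq_zero`). -/
theorem sum_hom_mul_eq_zero_of_shift [IsDomain R] (h2 : (2 : R) = 0) {ε : G} (hε : ε ≠ 1)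
    (hε2 : ε * ε = 1) (χ : G →* R) (hχε : χ ε = 1) (hχ : χ ≠ 1) (S : G → R) (c : R)
    (hS : ∀ t, S (ε * t) = S t + c) :
    ∑ t, χ t * S t = 0 := by
  classical
  have hεinv : ε⁻¹ = ε := inv_eq_of_mul_eq_one_right hε2
  let H : Subgroup G := pairSubgroup ε hε2
  -- `χ` descends to the quotient `G ⧸ {1, ε}`
  have hker : H ≤ χ.ker := by
    intro x hx
    rw [MonoidHom.mem_ker]
    rcases (mem_pairSubgroup hε2).mp hx with rfl | rfl
    · exact map_one χ
    · exact hχε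
  let χ' : G ⧸ H →* R := QuotientGroup.lift H χ hker
  have hχ'mk : ∀ t : G, χ' (t : G ⧸ H) = χ t := fun t => QuotientGroup.lift_mk H hker t
  have hχ' : χ' ≠ 1 := by
    intro h1
    apply hχ
    ext t
    rw [← hχ'mk t, h1, MonoidHom.one_apply, MonoidHom.one_apply]
  have hmkε : ∀ r : G, ((ε * r : G) : G ⧸ H) = (r : G ⧸ H) := by
    intro r
    apply QuotientGroup.eq.mpr
    rw [mem_pairSubgroup hε2]
    right
    calc (ε * r)⁻¹ * r = ε⁻¹ * (r⁻¹ * r) := by rw [mul_inv_rev, mul_comm r⁻¹ ε⁻¹, mul_assoc]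
      _ = ε := by rw [inv_mul_cancel, mul_one, hεinv]
  -- the fibre of `q : G ⧸ H` in `G` is `{q.out, ε * q.out}`
  have hfib : ∀ q : G ⧸ H,
      (univ.filter fun t : G => (t : G ⧸ H) = q) = {q.out, ε * q.out} := by
    intro q
    ext t
    simp only [mem_filter, mem_univ, true_and, mem_insert, mem_singleton]
    constructor
    · intro ht
      have ht' : ((q.out : G) : G ⧸ H) = (t : G ⧸ H) := by
        rw [ht]; exact QuotientGroup.out_eq' q
      have hmem : (q.out)⁻¹ * t ∈ H := QuotientGroup.eq.mp ht'
      rcases (mem_pairSubgroup hε2).mp hmem with h1 | h1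
      · left
        exact (inv_mul_eq_one.mp h1).symm
      · right
        rw [inv_mul_eq_iff_eq_mul.mp h1, mul_comm]
    · rintro (rfl | rfl)
      · exact QuotientGroup.out_eq' q
      · rw [hmkε]; exact QuotientGroup.out_eq' q
  have hne : ∀ q : G ⧸ H, q.out ≠ ε * q.out := by
    intro q h
    apply hε
    have h' : (1 : G) * q.out = ε * q.out := by simpa using h
    exact (mul_right_cancel h').symm
  -- regroup the sum along the fibres of `G → G ⧸ H`
  calc ∑ t, χ t * S t
      = ∑ q : G ⧸ H, ∑ t ∈ univ.filter (fun t : G => (t : G ⧸ H) = q), χ t * S t :=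
        (Finset.sum_fiberwise univ (fun t : G => (t : G ⧸ H)) (fun t => χ t * S t)).symm
    _ = ∑ q : G ⧸ H, c * χ' q := by
        refine sum_congr rfl fun q _ => ?_
        have hq' : χ' ((q.out : G) : G ⧸ H) = χ' q := congrArg χ' (QuotientGroup.out_eq' q)
        rw [hfib q, sum_pair (hne q), map_mul, hχε, one_mul, hS, ← hχ'mk q.out, hq']
        linear_combination (χ' q * S q.out) * h2
    _ = c * ∑ q : G ⧸ H, χ' q := (mul_sum _ _ _).symm
    _ = 0 := by rw [sum_hom_units_eq_zero χ' hχ', mul_zero]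

end Abstract

/-! ## §2 The module step: `j(w̄) = δ·w̄` with `N(δ) = −1` -/

section ModuleStep

/-- **41.15.2 (7) / 41.16.3, abstractly.**  `A` a commutative ring with an endomorphism `σ` (complex conjugation
on `ℤ[i]/m`, resp. `ℤ[ρ]/m`), `M` an `A`-module generated by `w` on which `w` is torsion-free (`C[m] ≅ A·w̄`),
`J : M → M` `σ`-semilinear (`j(γP) = γ̄·j(P)`, from `j ι j⁻¹ = ι⁻¹`) with `J (J x) = −x` (`j² = −1`, resp.
`ι₄² = −1`).  Then `J w = δ • w` with `σ δ * δ = −1`: the norm of `δ` is `−1`. -/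
theorem exists_smul_and_norm_eq_neg_one {A M : Type*} [CommRing A] [AddCommGroup M] [Module A M]
    {σ : A →+* A} (J : M →ₛₗ[σ] M) (w : M) (hgen : ∀ x : M, ∃ a : A, x = a • w)
    (hfree : ∀ a : A, a • w = 0 → a = 0) (hJ : ∀ x, J (J x) = -x) :
    ∃ δ : A, J w = δ • w ∧ σ δ * δ = -1 := by
  obtain ⟨δ, hδ⟩ := hgen (J w)
  refine ⟨δ, hδ, ?_⟩
  have h1 : J (J w) = (σ δ * δ) • w := by
    conv_lhs => rw [hδ, LinearMap.map_smulₛₗ, hδ, smul_smul]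
  have h2 : (σ δ * δ + 1) • w = 0 := by
    rw [add_smul, one_smul, ← h1, hJ, neg_add_cancel]
  have h3 := hfree _ h2
  linear_combination h3

end ModuleStep

/-! ## §3 The posited finite interface, the shadow moment, and the two vanishing theorems -/

section Interface

variable {k : Type*} [CommRing k] {m : ℕ} [NeZero m] {I : Type*} [Fintype I]

/-- **POSITED INTERFACE (T-es-42 (i)).**  The finite datum behind the supersingular shadow of 41.15 (5)–(7) /
41.16: for the CM curve `C` (`= 32a2`, `O_K = ℤ[i]`, `μ = μ₄`; resp. `27a3`, `O_K = ℤ[ρ]`, `μ = μ₆`), an odd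
modulus `m` prime to `6`, a prime `𝔔 | p` of `ℚ(C[m])` with residue field `k`, and a generator `w̄` of the free
rank-one `O_K/m`-module `C[m]`:
* `I` «=» `(O_K/m)ˣ / μ` (orbit representatives `δ`; `μ` acts through `Aut C`, so everything below is `μ`-invariant);
* `norm δ` «=» `N(δ) = δ δ̄ ∈ (ℤ/m)ˣ` (well defined since `N(μ) = 1`);
* `weight δ` «=» `ν_p(x̄(δ·w̄)) ∈ k`, `ν₂ = X(X + r̄)` (41.15 (6)), `ν₃ = X³ − r̄² X` (41.16.2), `x̄` the reduced
  coordinate of the good model at `𝔔`;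
* `jay` «=» the permutation of `I` induced by the quaternionic automorphism `j` of `C̃/𝔽₄` (resp. `ι₄` of `C̃/𝔽₉`):
  `δ ↦` class of `δ̄·δ_J`, where `J(w̄) = δ_J·w̄`, `N(δ_J) = −1` (§2);
* `norm_jay` : `N(δ̄ δ_J) = N(δ)·N(δ_J) = −N(δ)`.
The WEIGHT law of `jay` is not an axiom of the structure but a hypothesis of the theorems below:
p = 2: `weight (jay δ) = weight δ + 1` ([j]-lemma 41.15.2 (7): `ν₂(x̄(jP)) = ν₂(x̄(P)) + 1` on `C̃(𝔽₄) ∖ C̃[2]`);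
p = 3: `weight (jay δ) = − weight δ` ([ι₄]-lemma 41.16.3: `ν₃(−x̄) = −ν₃(x̄)`).  Both identities are landed-pending as
`ssTwo_nu_jay` / `ssThree_nu_iotaFour` (p707222, `…ManinAdditive.KatoCurve.ShadowLeader`). -/
structure ShadowDatum (k : Type*) [CommRing k] (m : ℕ) (I : Type*) [Fintype I] where
  /-- `δ ↦ N(δ) mod m` -/
  norm : I → (ZMod m)ˣ
  /-- `δ ↦ ν_p(x̄(δ·w̄))` -/
  weight : I → k
  /-- the permutation induced by `j` (p = 2) / `ι₄` (p = 3) -/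
  jay : I ≃ I
  /-- `N ∘ jay = −N` -/
  norm_jay : ∀ i, norm (jay i) = -norm i

namespace ShadowDatum

variable (D : ShadowDatum k m I)

/-- The fibre sum `S_t := ∑_{N(δ) = t} ν(δ)` (41.15 (7)). -/
def fibreSum (t : (ZMod m)ˣ) : k :=
  ∑ i ∈ univ.filter (fun i => D.norm i = t), D.weight i

/-- The fibre size `c_t := #{δ ∈ I : N(δ) = t}` (in the CM realisation `= |ker N|/|μ|`, independent of `t`). -/
def fibreCard (t : (ZMod m)ˣ) : ℕ :=
  (univ.filter (fun i => D.norm i = t)).card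

/-- **The supersingular shadow moment** `M̄(χ̄) := ∑_{δ ∈ I} χ̄(N δ)·ν_p(x̄(δ·w̄))` (41.15.0 `m̄₂(χ̄)`, indexed by
`I = (O/m)ˣ/μ₄` — the full sum over `(O/m)ˣ` is `|μ| · M̄ = 0` in characteristic `p`; 41.16.2 `M̄(χ̄)`). -/
def ssShadowMoment (χ : (ZMod m)ˣ →* k) : k :=
  ∑ i, χ (D.norm i) * D.weight i

/-- Regrouping by the norm: `M̄(χ̄) = ∑_t χ̄(t)·S_t`. -/
theorem ssShadowMoment_eq_sum_fibreSum (χ : (ZMod m)ˣ →* k) :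
    D.ssShadowMoment χ = ∑ t, χ t * D.fibreSum t := by
  unfold ssShadowMoment fibreSum
  rw [← Finset.sum_fiberwise univ D.norm (fun i => χ (D.norm i) * D.weight i)]
  refine sum_congr rfl fun t _ => ?_
  rw [mul_sum]
  refine sum_congr (by congr) fun i hi => ?_
  rw [(mem_filter.mp hi).2]

omit [NeZero m] in
/-- Reindexing a fibre by `jay`: `S_{−t} = ∑_{N δ = t} ν(jay δ)`. -/
theorem fibreSum_neg_eq_sum_jay (t : (ZMod m)ˣ) :
    D.fibreSum (-t) = ∑ i ∈ univ.filter (fun i => D.norm i = t), D.weight (D.jay i) := by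
  unfold fibreSum
  symm
  refine Finset.sum_equiv D.jay (fun i => ?_) (fun i _ => rfl)
  simp only [mem_filter, mem_univ, true_and, D.norm_jay, neg_inj]

omit [NeZero m] in
/-- `jay` maps the fibre of `t` onto the fibre of `−t`: `c_{−t} = c_t`. -/
theorem fibreCard_neg (t : (ZMod m)ˣ) : D.fibreCard (-t) = D.fibreCard t := by
  unfold fibreCard
  symm
  refine Finset.card_equiv D.jay (fun i => ?_)
  simp only [mem_filter, mem_univ, true_and, D.norm_jay, neg_inj]

omit [NeZero m] in
/-- p = 2 SHIFT LAW (41.15.2 (7)): `ν(jay δ) = ν(δ) + 1` ⟹ `S_{−t} = S_t + c_t`. -/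
theorem fibreSum_neg_of_weight_jay_eq_add_one
    (hw : ∀ i, D.weight (D.jay i) = D.weight i + 1) (t : (ZMod m)ˣ) :
    D.fibreSum (-t) = D.fibreSum t + D.fibreCard t := by
  rw [fibreSum_neg_eq_sum_jay]
  unfold fibreSum fibreCard
  simp only [hw, sum_add_distrib, sum_const, nsmul_eq_mul, mul_one]

omit [NeZero m] in
/-- p = 3 SHIFT LAW (41.16.3): `ν(jay δ) = −ν(δ)` ⟹ `S_{−t} = −S_t`. -/
theorem fibreSum_neg_of_weight_jay_eq_neg
    (hw : ∀ i, D.weight (D.jay i) = -D.weight i) (t : (ZMod m)ˣ) :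
    D.fibreSum (-t) = -D.fibreSum t := by
  rw [fibreSum_neg_eq_sum_jay]
  unfold fibreSum
  simp only [hw, sum_neg_distrib]

/-- **E-es-128′-fin (p = 2 SHADOW VANISHING, = THEOREM 41.15 step (8), typer (a)).**  `k` a domain of
characteristic `2`, `−1 ≠ 1` in `(ℤ/m)ˣ` (`m ≥ 3`), the [j]-weight law, fibres of constant size `c`; then for
every NON-TRIVIAL `χ̄ : (ℤ/m)ˣ →* k` with `χ̄(−1) = 1` (automatic for `χ̄` of odd order) the shadow moment vanishes.
In the CM dictionary (41.15 (5)–(6), NOT typed here) this is `v_𝔔(S(χ)) > 3/2`, i.e. `2 ∣ B₁(χ)` = Kato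
integrality at `E₁ = 32a2` = C2(32a) beyond `c₁ = 2`. -/
theorem ssShadowMoment_eq_zero_of_char_two [IsDomain k] (h2 : (2 : k) = 0)
    (hm : (-1 : (ZMod m)ˣ) ≠ 1) (hw : ∀ i, D.weight (D.jay i) = D.weight i + 1)
    (c : ℕ) (hc : ∀ t, D.fibreCard t = c)
    (χ : (ZMod m)ˣ →* k) (hχ : χ ≠ 1) (hχε : χ (-1) = 1) :
    D.ssShadowMoment χ = 0 := by
  rw [ssShadowMoment_eq_sum_fibreSum]
  refine sum_hom_mul_eq_zero_of_shift h2 hm (by simp) χ hχε hχ D.fibreSum (c : k) (fun t => ?_)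
  rw [neg_one_mul, fibreSum_neg_of_weight_jay_eq_add_one D hw t, hc t]

/-- **E-es-128-fin-even (p = 3, EVEN characters, = 41.16.3).**  `2 ≠ 0` in `k` (e.g. characteristic `3`), the
[ι₄]-weight law; then for every `χ̄ : (ℤ/m)ˣ →* k` with `χ̄(−1) = 1` the shadow moment vanishes («the shadow is
blind on the even side», consistent with the even-side integrality at `27a` being governed by period domination,
41.10/41.14).  The ODD half of E-es-128 (`χ̄(−1) = −1`: `v₃(A⁻(χ)) ≥ 1 ⟺ M̄(χ̄) = 0`, SS-SHADOW3-v1 21/21) is the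
leading-term statement and is NOT typed here. -/
theorem ssShadowMoment_eq_zero_of_two_ne_zero [NoZeroDivisors k] (h2 : (2 : k) ≠ 0)
    (hw : ∀ i, D.weight (D.jay i) = -D.weight i)
    (χ : (ZMod m)ˣ →* k) (hχε : χ (-1) = 1) :
    D.ssShadowMoment χ = 0 := by
  rw [ssShadowMoment_eq_sum_fibreSum]
  refine sum_hom_mul_eq_zero_of_antisymm h2 (-1) χ hχε D.fibreSum (fun t => ?_)
  rw [neg_one_mul, fibreSum_neg_of_weight_jay_eq_neg D hw t]

end ShadowDatum

end Interface

/-! ## §4 TYPED CANDIDATES E-es-129-T2 / E-es-129-T3 — CM PERIOD DOMINATION BY THE STRONG WEIL CURVE (MEMO-es §41.19, §42.4)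

Statements over tree declarations only (`IsOptimalModel`, `WeierstrassCurve.IsIsogenous`, `realPeriodRat`,
`imaginaryPeriodRat`, `WeierstrassCurve.j`, `conductorNorm`).  BC5 WITNESS = the census tables CM-DOMINATION-v1.txt
97894366251a2d6c (p = 2: 649 classes with a `j = 1728` member, `N < 500 000`, unique exception 32a) and CM-DOMINATION2-v1.txt
939dc9a293d6b395 (p = 3: 1848 classes with a `j = 0` member, unique real exception 27a, NO imaginary exception), HOME/es/g27.
CONSUMPTION BY NAME: `katoFactTwoAt_of_isIsogenous_of_realPeriod_ratio` (p702793) / `katoFactThreeAt_of_isIsogenous_of_period_ratios`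
(p703560) turn T2 ∧ «Kato at the optimal curve» into E-es-124 off class 32a, resp. T3 ∧ «Kato₃ at the optimal curve» into E-es-125 off
class 27a (file HOME/es/g28/Consume-es-g28.lean, farm rc 0 · nothing admitted).  Nothing is asserted; `@[conjecture]`-grade obligation nodes. -/

section PeriodDomination

open WeierstrassCurve Literature.NumberTheory.EllipticCurves Literature.NumberTheory.EllipticCurves.ModularForms

/-- **E-es-129-T2 (CM PERIOD DOMINATION at p = 2, `j = 1728` band).**  For every globally minimal `V/ℚ` with `j(V) = 1728`
and every globally minimal model `W` of the `X₀`-optimal (strong Weil) curve of its isogeny class, of conductor `≠ 32`: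
the FULL real period of `W` is `2`-adically at least that of `V` — `q·Ω(W) = m·Ω(V)` with `q` odd, `m ∈ ℤ`.
(Equivalently `v₂(Ω(V)/Ω(W)) ≤ 0`; the excluded class 32a has `Ω(32a2) = 2·Ω(32a1)` — the Γ₁-bit of THEOREM 41.15.)
EVIDENCE: CM-DOMINATION-v1 (649/649 classes below 500 000, two engines on Ω); conjecturally for all `N` via Stevens' `E₁ = E_min` +
Stein–Watkins (41.19.7 (iii)).  NOT in print as a statement (41.19.6). -/
@[conjecture]
def CMPeriodDominationTwo : Prop :=
  ∀ (V W : WeierstrassCurve ℚ) [V.IsElliptic] [V.IsGloballyMinimal] [W.IsElliptic] [W.IsGloballyMinimal],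
    V.j = 1728 → IsOptimalModel W → WeierstrassCurve.IsIsogenous W V → W.conductorNorm ℤ ≠ 32 →
      ∃ q m : ℤ, Odd q ∧ (q : ℝ) * W.realPeriodRat = (m : ℝ) * V.realPeriodRat

/-- **E-es-129-T3 (CM PERIOD DOMINATION at p = 3, `j = 0` band).**  For every globally minimal `V/ℚ` with `j(V) = 0` and every
globally minimal model `W` of the `X₀`-optimal curve of its class, of conductor `≠ 27`: `q·Ω⁺(W) = m·Ω⁺(V)` and
`q′·|Ω⁻|(W) = m′·|Ω⁻|(V)` with `3 ∤ q q′`.  (The excluded class 27a has `Ω(27a3) = 3·Ω(27a1)` — THEOREM 41.16's Γ₁-3 — and NO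
imaginary exception.)  EVIDENCE: CM-DOMINATION2-v1 (1848/1848 classes below 500 000: real column two engines, imaginary column one
AGM engine, 0 exceptions off 27a).  NOT in print as a statement. -/
@[conjecture]
def CMPeriodDominationThree : Prop :=
  ∀ (V W : WeierstrassCurve ℚ) [V.IsElliptic] [V.IsGloballyMinimal] [W.IsElliptic] [W.IsGloballyMinimal],
    V.j = 0 → IsOptimalModel W → WeierstrassCurve.IsIsogenous W V → W.conductorNorm ℤ ≠ 27 →
      ∃ q m q' m' : ℤ, ¬ (3 : ℤ) ∣ q ∧ ¬ (3 : ℤ) ∣ q' ∧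
        (q : ℝ) * W.realPeriodRat = (m : ℝ) * V.realPeriodRat ∧
        (q' : ℝ) * W.imaginaryPeriodRat = (m' : ℝ) * V.imaginaryPeriodRat

end PeriodDomination

end Summit.BirchSwinnertonDyer.Rank1Residual.ManinAdditive.KatoCurve.ShadowMoment
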